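import Summits.ABC.IUTFork.Repair.RHRound4TLinear
import HarnessLib

/-!
# R-H ROUND 4, R4IDEA-TLINEAR — rider to `RHRound4TLinear` (p545946): the memo's FINAL (v1.2) normalisation — the DILATION `ρ(V) = u_mod(V)/u(l)`, «T linear» := `ρ ≤ μ₀(1+ε)`,
# print's level-`l` edge `H⁰_w(l) = 2l·Π⁰_w/(e_w·S₂)`, the EXCHANGE-RATE LAW `ρ ≥ φ_w·H_w/H⁰_w(l)` (PROVED) and the EXACT worked rate `H_w/H⁰_w(107) = M/Π = 10 707 060/9 414 496`

abc-iut cell, rung LADDER-ABC:A2.RESCUE.H; seat abc-iut-rh4-typ-1 (GEN 0, R4-3 TYPER, KEY `wake/KEY-abc-iut-rh4-typ-1-R4IDEA-TYPE.md` 2342d1cdeb6caa1f; desk R93 «R-TL typing CONFIRMED in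
scope»). SOURCE OF RECORD: abc-iut-rh4-id-1 g1's memo `plan/rescue/R-H/ROUND4/R4-TLINEAR-REQUIREMENTS-rh4-id-1.md` v1.2 FINAL **0d31afcbc09184ab** (supersedes v1 9ca0ccf867bdf0c4,
which `RHRound4TLinear` types in the `E⋆`-normalisation): v1.1/v1.2 «normalisation aligned with kit-1 (D′) (print's u(l)/6 sits inside (1+20·d_mod/l)); everything restated in the
dilation ρ(V) := u_mod(V)/u(l) = (Σ_J pk/Σ(j+1))·(S₂/S_f), E(V) = 6ρ(1+20d_mod/l)/μ₀: «T linear» ⇔ ρ ≤ μ₀(1+ε) …; EXCHANGE-RATE LAW ρ(V) ≥ φ_w·H_w/H⁰_w(l) with H⁰_w(l) :=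
2l·Π⁰_w/(e_w·S₂(l⋆)) = PRINT'S OWN level-l full-licence edge (→ 6A_w/e_w); FREY p=7 l=107: H_w = 28.000, H⁰_w(l) = 24.620, H_w/H⁰_w(l) = 1.1373 = M/Π = 10 707 060/9 414 496
EXACTLY». This file adds exactly that, BY NAME over `RHRound4TLinear` (`Variant`, `Place`, `A`, `S`, `countSum`, `Estar`, `H`, `H0`, `demand`, `Coupled`, `LicensedOn`,
`licensedMass_le`, `frey7`, `print107`, `print13`) and p506542 `RHReqsideWeightLaws` (`demandSum`, `six_mul_demandSum_sq`, `demandSum_sq_pos` — print's `S₂` BY NAME), and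
PROVES the two normalisations equivalent: `rho_eq_Estar` (`ρ = E⋆·μ₀/u(l)`), `H0l_eq` (`H⁰_w(l) = H⁰_w·u(l)/6`), `tlinearRho_iff` (`ρ ≤ μ₀(1+ε) ⇔ E⋆ ≤ u(l)(1+ε)`).
WHAT IS TYPED (same namespace `Summit.ABC.IUTFork.Repair.RH.Round4TLinear`; plain `def`, no instance, no notation, every def `@[claim "Mochizuki2012" "disputed"]`): `countPrint l`
(`Σ_{j=1}^{l⋆}(j+1)`), `S2 l` (`S₂(l⋆)`), `uPrint l` (`u(l)`), `rho V`, `TLinearRho V ε`, `Erealised V d_mod`, `Pi0 P l`, `H0l P l`; PROVED: closed forms `two_mul_countPrint`,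
`six_mul_S2`, signs `S2_nonneg`, `countPrint_pos` (`l ≥ 3`), `S2_pos` (`l ≥ 5`), the bridges above, **`exchangeRate_rho`**, **`tlinear_window_rho`**, and the worked numerals
`frey7_l107_rate` (`Σ(j+1) = 1484 ∧ S₂(53) = 50986 ∧ Π⁰ = 9 414 496 ∧ H⁰_w(107) = 2·107·9414496/(1605·50986) ∧ H/H⁰_w(107) = 10707060/9414496`), `uPrint_13` (`u(13) = 702/85 =
E⋆(print13)`).
HONEST FRAMING / GUARDS: statements about OUR typed cell currency (REQB/TOPT margins; memo hypotheses H1–H4), typed so they can be attacked; `TLinearRho` is a REQUIREMENT asserted of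
no scheme; no Literature fact is added (inputs ⊆ the frozen FACT-LIST f75a60bac22efdb6 + p506542 + p545946); the theorems are real arithmetic; typed ≠ proved for every IUT locution;
computed ≠ proved; nothing here asserts that abc is proved or refuted, or takes a side on [IUTchIII] Cor. 3.12 / [IUTchIV] Thm. 1.10 or on any author (D-0045: located, not
adjudicated). [claim: Mochizuki2012, status: disputed] [cite: Mochizuki2012, IUTchIII Cor. 3.12 p. 173–174, Rmk. 3.12.2; IUTchIV Prop. 1.2 p. 10, Thm. 1.10 Step (v)–(viii)
p. 27–29] [cite: ScholzeStix2018, §2.2 p. 10]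
-/

noncomputable section

open Finset

namespace Summit.ABC.IUTFork.Repair.RH.Round4TLinear

open Summit.ABC.IUTFork.Repair.RH.ReqsideWeightLaws

/-! ## §5 (rider). The DILATION `ρ(V) = u_mod(V)/u(l)` and print's level-`l` edge `H⁰_w(l)` (memo v1.2 §2.1/§2.3/§3)

v1.2 restates the same law relative to PRINT'S OWN level-`l` exponent `u(l) = 2l·Σ(j+1)/S₂(l⋆)` instead of the limit `6`: `ρ(V) := (Σ_J pk/Σ_{j=1}^{l⋆}(j+1))·(S₂(l⋆)/S_f(J))
= E⋆(V)·μ₀/u(l)` (`rho_eq_Estar`), «T linear» := `ρ ≤ μ₀(1+ε)` (⇔ `E⋆ ≤ u(l)·(1+ε)`, `tlinearRho_iff`), `Π⁰_w(l) := A_w·Σ(j+1)`, `H⁰_w(l) := 2l·Π⁰_w/(e_w·S₂) = H⁰_w·u(l)/6`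
(`H0l_eq`), and the EXCHANGE-RATE LAW reads `ρ(V) ≥ φ_w·H_w/H⁰_w(l)` (`exchangeRate_rho`, PROVED) with window `φ_w ≤ μ₀(1+ε)·H⁰_w(l)/H_w` (`tlinear_window_rho`); at the worked
place FREY `p = 7`, `l = 107` the rate is EXACT: `H_w/H⁰_w(l) = M/Π = 10 707 060/9 414 496 (= 1.1373…)` (`frey7_l107_rate`; p531802 §3). `S₂` is p506542's `demandSum` BY NAME. -/

/-- `Σ_{j=1}^{l⋆} (j + 1)` (`l⋆ = (l − 1)/2`), print's total identification COUNT at level `l`, written over `i = j − 1 ∈ range l⋆` (closed form `l⋆(l⋆+3)/2`,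
`two_mul_countPrint`). [claim: Mochizuki2012, status: disputed] -/
@[claim "Mochizuki2012" "disputed"]
def countPrint (l : ℕ) : ℝ := ∑ i ∈ Finset.range ((l - 1) / 2), ((i : ℝ) + 2)

/-- `S₂(l⋆) := Σ_{j=1}^{l⋆} (j² − 1)` — print's demand total, = p506542 `demandSum (j ↦ j²) 1 l⋆` BY NAME (closed form `6·S₂ = l⋆(l⋆−1)(2l⋆+5)`, `six_mul_demandSum_sq`).
[claim: Mochizuki2012, status: disputed] -/
@[claim "Mochizuki2012" "disputed"]
def S2 (l : ℕ) : ℝ := ((demandSum (fun j => (j : ℤ) ^ 2) 1 ((l - 1) / 2) : ℤ) : ℝ)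

/-- `u(l) := 2l·Σ(j+1)/S₂(l⋆)` — print's own level-`l` shape exponent (`= E⋆` of print's scheme with `μ₀ = 1`; `6l(l+5)/((l−3)(l+4)) → 6`; `702/85` at `l = 13`).
[claim: Mochizuki2012, status: disputed] -/
@[claim "Mochizuki2012" "disputed"]
def uPrint (l : ℕ) : ℝ := 2 * (l : ℝ) * countPrint l / S2 l

/-- **THE DILATION `ρ(V) := (Σ_J pk/Σ_{j=1}^{l⋆}(j+1))·(S₂(l⋆)/S_f(J))`** (memo v1.2 §2.1: `ρ = u_mod(V)/u(l)`; realised exponent `E(V) = 6ρ(1+20·d_mod/l)/μ₀`).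
[claim: Mochizuki2012, status: disputed] -/
@[claim "Mochizuki2012" "disputed"]
def rho (V : Variant) : ℝ := countSum V / countPrint V.l * (S2 V.l / S V)

/-- **«T LINEAR» in the v1.2 normalisation := `ρ(V) ≤ μ₀·(1 + ε)`** (memo v1.2 §2.1; ⇔ `E⋆ ≤ u(l)·(1+ε)`, `tlinearRho_iff`). A REQUIREMENT, asserted of no scheme.
[claim: Mochizuki2012, status: disputed] -/
@[claim "Mochizuki2012" "disputed"]
def TLinearRho (V : Variant) (ε : ℝ) : Prop := rho V ≤ V.μ₀ * (1 + ε)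

/-- The realised Szpiro-shape exponent of the scheme, `E(V) := 6ρ(V)·(1 + 20·d_mod/l)/μ₀` (memo v1.2 §2.1, kit-1 (D′) bookkeeping; `d_mod` a parameter here).
[claim: Mochizuki2012, status: disputed] -/
@[claim "Mochizuki2012" "disputed"]
def Erealised (V : Variant) (dmod : ℝ) : ℝ := 6 * rho V * (1 + 20 * dmod / (V.l : ℝ)) / V.μ₀

/-- `Π⁰_w(l) := A_w·Σ_{j=1}^{l⋆}(j+1)` — print's full-licence price edge of the place at level `l` (FREY `p = 7`, `l = 107`: `6344·1484 = 9 414 496`, p531802 §3).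
[claim: Mochizuki2012, status: disputed] -/
@[claim "Mochizuki2012" "disputed"]
def Pi0 (P : Place) (l : ℕ) : ℝ := A P * countPrint l

/-- `H⁰_w(l) := 2l·Π⁰_w(l)/(e_w·S₂(l⋆))` — print's OWN level-`l` full-licence edge in height units (`= H⁰_w·u(l)/6 → 6A_w/e_w`; FREY 7/107: `24.6198…`).
[claim: Mochizuki2012, status: disputed] -/
@[claim "Mochizuki2012" "disputed"]
def H0l (P : Place) (l : ℕ) : ℝ := 2 * (l : ℝ) * Pi0 P l / (P.e * S2 l)

/-- Closed form of the count: `2·Σ_{j=1}^{n}(j+1) = n(n+3)` with `n = l⋆`. [folklore] -/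
theorem two_mul_countPrint (l : ℕ) : 2 * countPrint l = (((l - 1) / 2 : ℕ) : ℝ) * ((((l - 1) / 2 : ℕ) : ℝ) + 3) := by
  unfold countPrint
  induction ((l - 1) / 2 : ℕ) with
  | zero => simp
  | succ n ih => rw [Finset.sum_range_succ, mul_add, ih]; push_cast; ring

/-- Closed form of print's demand total: `6·S₂ = n(n−1)(2n+5)`, `n = l⋆` (p506542 `six_mul_demandSum_sq`, cast to `ℝ`). [folklore] -/
theorem six_mul_S2 (l : ℕ) : 6 * S2 l = (((l - 1) / 2 : ℕ) : ℝ) * ((((l - 1) / 2 : ℕ) : ℝ) - 1) * (2 * (((l - 1) / 2 : ℕ) : ℝ) + 5) := by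
  unfold S2
  have h := congrArg (fun z : ℤ => (z : ℝ)) (six_mul_demandSum_sq ((l - 1) / 2))
  simp only [Int.cast_mul, Int.cast_ofNat, Int.cast_natCast, Int.cast_sub, Int.cast_one, Int.cast_add] at h
  linarith [h]

/-- `S₂ ≥ 0` at every level. [folklore] -/
theorem S2_nonneg (l : ℕ) : 0 ≤ S2 l := by
  have h := six_mul_S2 l
  rcases Nat.eq_zero_or_pos ((l - 1) / 2) with h0 | hpos
  · rw [h0] at h; push_cast at h; linarith
  · have h1 : (1 : ℝ) ≤ (((l - 1) / 2 : ℕ) : ℝ) := by exact_mod_cast hpos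
    nlinarith [mul_nonneg (mul_nonneg (by linarith : (0 : ℝ) ≤ (((l - 1) / 2 : ℕ) : ℝ)) (by linarith : (0 : ℝ) ≤ (((l - 1) / 2 : ℕ) : ℝ) - 1))
      (by linarith : (0 : ℝ) ≤ 2 * (((l - 1) / 2 : ℕ) : ℝ) + 5)]

/-- `Σ(j+1) > 0` as soon as `l ≥ 3` (`l⋆ ≥ 1`). [folklore] -/
theorem countPrint_pos {l : ℕ} (hl : 3 ≤ l) : 0 < countPrint l := by
  have h := two_mul_countPrint l
  have h1 : (1 : ℝ) ≤ (((l - 1) / 2 : ℕ) : ℝ) := by exact_mod_cast (show 1 ≤ (l - 1) / 2 by omega)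
  nlinarith

/-- `S₂ > 0` as soon as `l ≥ 5` (`l⋆ ≥ 2`; p506542 `demandSum_sq_pos`). [folklore] -/
theorem S2_pos {l : ℕ} (hl : 5 ≤ l) : 0 < S2 l := by
  unfold S2
  exact_mod_cast demandSum_sq_pos (show 2 ≤ (l - 1) / 2 by omega)

/-- **v1 ↔ v1.2**: `ρ(V) = E⋆(V)·μ₀/u(l)` (`μ₀ ≠ 0`, `l ≥ 5`). [folklore] -/
theorem rho_eq_Estar (V : Variant) (hμ : V.μ₀ ≠ 0) (hl : 5 ≤ V.l) : rho V = Estar V * V.μ₀ / uPrint V.l := by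
  have hC := (countPrint_pos (show 3 ≤ V.l by omega)).ne'
  have hS2 := (S2_pos hl).ne'
  have hl' : (V.l : ℝ) ≠ 0 := by exact_mod_cast (show V.l ≠ 0 by omega)
  rcases eq_or_ne (S V) 0 with hS | hS
  · simp [rho, Estar, hS]
  · unfold rho Estar uPrint
    field_simp

/-- **v1 ↔ v1.2 on the edge**: `H⁰_w(l) = H⁰_w·u(l)/6`. [folklore] -/
theorem H0l_eq (P : Place) (l : ℕ) : H0l P l = H0 P * uPrint l / 6 := by
  simp only [H0l, H0, uPrint, Pi0]
  ring

/-- **v1 ↔ v1.2 on «T linear»**: `ρ ≤ μ₀(1+ε) ⇔ E⋆ ≤ u(l)·(1+ε)` (`μ₀ > 0`, `l ≥ 5`, `S_f > 0`). Since `u(l) > 6` at every level, v1's `TLinear` (`E⋆ ≤ 6(1+ε)`) is the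
slightly STRONGER requirement. [folklore] -/
theorem tlinearRho_iff (V : Variant) (ε : ℝ) (hμ : 0 < V.μ₀) (hl : 5 ≤ V.l) : TLinearRho V ε ↔ Estar V ≤ uPrint V.l * (1 + ε) := by
  have hC := countPrint_pos (show 3 ≤ V.l by omega)
  have hS2 := S2_pos hl
  have hl' : (0 : ℝ) < (V.l : ℝ) := by exact_mod_cast (show 0 < V.l by omega)
  have hu : 0 < uPrint V.l := by unfold uPrint; positivity
  unfold TLinearRho
  rw [rho_eq_Estar V hμ.ne' hl, div_le_iff₀ hu]
  constructor
  · intro h; nlinarith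
  · intro h; nlinarith

/-- **THE EXCHANGE-RATE LAW, v1.2 form** (memo v1.2 §2.3): coupled + licensed on `Lw ⊆ J` with fraction `φ` (`φ·m_q·S_f = Σ_{Lw} d_f`), counts `≥ 0`, `S_f, m_q, e_w, A_w > 0`,
`l ≥ 3` ⟹ `φ·H_w/H⁰_w(l) ≤ ρ(V)`. [folklore] -/
theorem exchangeRate_rho {V : Variant} {P : Place} {cap : ℕ → ℝ} {Lw : Finset ℕ} {φ : ℝ} (hc : Coupled V P cap) (hL : LicensedOn V P cap Lw)
    (hφ : φ * (P.mq * S V) = ∑ j ∈ Lw, demand V P j) (hpk : ∀ j ∈ V.J, 0 ≤ V.pk j) (hS : 0 < S V) (hm : 0 < P.mq) (he : 0 < P.e) (hA : 0 < A P)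
    (hl : 3 ≤ V.l) : φ * H V P / H0l P V.l ≤ rho V := by
  have hmass : φ * (P.mq * S V) ≤ A P * countSum V := hφ ▸ licensedMass_le hc hL hpk hA.le
  have hC := countPrint_pos hl
  have hS2 := S2_nonneg V.l
  have hl' : (0 : ℝ) < (V.l : ℝ) := by exact_mod_cast (show 0 < V.l by omega)
  rcases hS2.eq_or_lt with hz | hS2pos
  · -- degenerate level (`S₂ = 0`, i.e. `l⋆ ≤ 1`): both sides vanish
    have h1 : H0l P V.l = 0 := by unfold H0l; rw [← hz]; simp
    have h2 : rho V = 0 := by unfold rho; rw [← hz]; simp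
    rw [h1, h2, div_zero]
  unfold H H0l Pi0 rho
  rw [show φ * (2 * (V.l : ℝ) * P.mq / P.e) / (2 * (V.l : ℝ) * (A P * countPrint V.l) / (P.e * S2 V.l)) = φ * P.mq * S2 V.l / (A P * countPrint V.l) by
    field_simp]
  rw [div_mul_div_comm, div_le_div_iff₀ (mul_pos hA hC) (mul_pos hC hS)]
  have key : φ * P.mq * S V ≤ A P * countSum V := by rw [mul_assoc]; exact hmass
  nlinarith [mul_le_mul_of_nonneg_left key (mul_nonneg hS2pos.le hC.le)]

/-- **THE T-LINEAR WINDOW, v1.2 form** (memo v1.2 COROLLARY): `ρ ≤ μ₀(1+ε)` ⟹ `φ ≤ μ₀(1+ε)·H⁰_w(l)/H_w` (`l ≥ 5`). [folklore] -/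
theorem tlinear_window_rho {V : Variant} {P : Place} {cap : ℕ → ℝ} {Lw : Finset ℕ} {φ ε : ℝ} (hT : TLinearRho V ε) (hc : Coupled V P cap)
    (hL : LicensedOn V P cap Lw) (hφ : φ * (P.mq * S V) = ∑ j ∈ Lw, demand V P j) (hpk : ∀ j ∈ V.J, 0 ≤ V.pk j) (hS : 0 < S V) (hm : 0 < P.mq)
    (he : 0 < P.e) (hA : 0 < A P) (hl : 5 ≤ V.l) : φ ≤ V.μ₀ * (1 + ε) * H0l P V.l / H V P := by
  have hrate := exchangeRate_rho hc hL hφ hpk hS hm he hA (show 3 ≤ V.l by omega)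
  have hC := countPrint_pos (show 3 ≤ V.l by omega)
  have hS2 := S2_pos hl
  have hl' : (0 : ℝ) < (V.l : ℝ) := by exact_mod_cast (show 0 < V.l by omega)
  have hH : 0 < H V P := by unfold H; positivity
  have hH0 : 0 < H0l P V.l := by unfold H0l Pi0; positivity
  have h1 : φ * H V P / H0l P V.l ≤ V.μ₀ * (1 + ε) := hrate.trans hT
  rw [div_le_iff₀ hH0] at h1
  rw [le_div_iff₀ hH]
  linarith

/-- The worked place at print's level `l = 107` (memo v1.2 §3 instance `frey7_l107`): `Σ(j+1) = 1484`, `S₂(53) = 50 986`, `Π⁰ = 6344·1484 = 9 414 496`,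
`H⁰_w(107) = 2·107·9 414 496/(1605·50 986) (= 24.6198…)`, and the EXACT rate `H_w/H⁰_w(107) = 10 707 060/9 414 496 = M/Π (= 1.1373…)` of p531802 §3. [folklore] -/
theorem frey7_l107_rate : countPrint 107 = 1484 ∧ S2 107 = 50986 ∧ Pi0 frey7 107 = 9414496 ∧ H0l frey7 107 = 2 * 107 * 9414496 / (1605 * 50986) ∧
    H print107 frey7 / H0l frey7 107 = 10707060 / 9414496 := by
  have hC : countPrint 107 = 1484 := by
    have h := two_mul_countPrint 107
    norm_num at h
    linarith
  have hS : S2 107 = 50986 := by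
    have h := six_mul_S2 107
    norm_num at h
    linarith
  have hP : Pi0 frey7 107 = 9414496 := by
    unfold Pi0; rw [hC]; simp only [A, frey7]; norm_num
  refine ⟨hC, hS, hP, ?_, ?_⟩
  · unfold H0l; rw [hP, hS]; simp only [frey7]; norm_num
  · unfold H0l H; rw [hP, hS]; simp only [frey7, print107]; norm_num

/-- Consistency at `l = 13`: `u(13) = 702/85 = E⋆(print13)` (`print13_Estar`). [folklore] -/
theorem uPrint_13 : uPrint 13 = 702 / 85 ∧ Estar print13 = uPrint 13 := by
  have hC : countPrint 13 = 27 := by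
    have h := two_mul_countPrint 13
    norm_num at h
    linarith
  have hS : S2 13 = 85 := by
    have h := six_mul_S2 13
    norm_num at h
    linarith
  have hu : uPrint 13 = 702 / 85 := by
    unfold uPrint; rw [hC, hS]; norm_num
  exact ⟨hu, by rw [hu]; exact print13_Estar.2.2⟩

end Summit.ABC.IUTFork.Repair.RH.Round4TLinear

end
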